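import Literature.MathematicalPhysics.QuantumFieldTheory.Balaban1983to89.B5Display133G0Torus
import Literature.MathematicalPhysics.QuantumFieldTheory.Balaban1983to89.B5TowerSourcesG0

/-!
# `Balaban1983to89.B5G0DiagTorus` — Bałaban's operator G₀ ON 1-FORMS as ONE setting per torus: the diagonal vector
# operator G₀ = ⊕_μ G₀^{(μ)} on sources of the three kinds of (1.89) (vector, tensor, 2-tensor), and THE DIAGONAL
# ASSEMBLY: its Proposition 1.2 from the per-direction scalar family (`B5G0SettingTorus.famG0`) and (1.114)

statement-level skeleton of published theorems with citation tags; proofs where landed; nothing here is a claim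
about the Yang–Mills mass gap

Source (lit-balaban / pub-balaban cells): T. Bałaban, *Propagators and renormalization transformations for lattice
gauge theories. I*, Commun. Math. Phys. **95** (1984) 17–40 [`Balaban1984PropagatorsI`, "B5"], p. 39 [PDF 23]
((1.132)–(1.134)), p. 33 [PDF 17] (Prop. 1.1 (1.89)–(1.90)), pp. 35–36 [PDF 19–20] (Prop. 1.2 (1.108)–(1.114)); held as
`paper:balaban1984-cmp95-propagators-rt-i`.

## WHAT IS PRINTED (verbatim, p. 39 [PDF 23]; docstring v1.1 — the located sentences, per the second reader r05 pass 12;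
## docstring v1.2 — r05 pass 27 (c): in the cite tag of `famScalar` the gloss «its projection on one component» (OUR words;
## p. 39 L16–17 prints «where G₀ = (Δ + aQ*Q)⁻¹. This operator is similar to G′, but with the different averaging
## operator.») is moved out of the guillemets; declarations byte-identical)

«This proof, and also a proof of (1.115)–(1.117), makes use of the identity G = G₀ + G₀∂P∂*G, (1.132) where
G₀ = (Δ + aQ*Q)⁻¹. This operator is similar to G′, but with the different averaging operator. We will prove (1.115)–(1.117),
and in fact the whole Proposition 1.2, for the operator G₀.»  NOT PRINTED, this module's reading of «similar to G′»: G₀ is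
diagonal in the vector indices, each component being a scalar operator of the type considered in [2] with the averaging Q
(the v1.0 header presented this paraphrase as a quotation; corrected here, content of the module unchanged).

## WHAT THIS MODULE ADDS (kernel-checked, zero sorry)

`B5G0SettingTorus.g0Setting P a m² k μ` is the per-direction scalar reading (one projection G₀^{(μ)} applied to every
component of a vector source, index (torus, μ)) — the cheap side of the (1.133)-transfer from G′ ⊗ 1
(`B5Display133G0Torus.prop12G0_torus`).  The (1.132)-transfer G₀ ↝ G = Δ_a⁻¹ (`B5Transfer132`, cell r02) compares, torus
by torus, ALL output components of the non-diagonal G with G₀ — it needs G₀ as ONE setting per torus acting DIAGONALLY on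
1-forms, with the three kinds of sources of (1.89).  This module supplies that object and derives its Proposition 1.2:
§1 the sources are r02's `B5TowerSourcesG0.LocT P` (vec | ten | ten2) with its `suppInT`, `supNormT`, `l2NormT` — REUSED, one
   vocabulary for the cell; generic Hölder norms of finite families (`holG`), rows of tensor sources, the diagonal kernels `dK0` (G₀A)_μ = G₀^{(μ)}A_μ, `dKD`,
   `dKL`, `dKD2`, `dDiv` (G₀∇*T)_μ = G₀^{(μ)}Σ_ν∂*_νT_{νμ}, `dDD`, `dDiv2` — all in the `dEta/lapEta/G0` vocabulary;
§2 **`g0Diag P a m² k : B5.Setting`** — index the torus ALONE; fields kind by kind exactly as r02's lattice setting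
   `B5Prop12FieldsLattice.eL/h1L/e4L/h2L/l2locL` (vec ↦ entries 0, 1, 3 and L² members 0, 1, 4; ten ↦ entry 2, e4, h2 and
   members 2, 3; ten2 ↦ member 5 = ‖ζG₀∇*∇*T‖, REAL here); the (1.111) entry per kind (vec: ‖ζ∇G₀A‖_α, ten: ‖ζG₀∇*T‖_α);
   `l2op m J` := the member with ζ = 1; Vec := 1-forms, formΔa A = Σ_μ η^d⟨A_μ, (Δ + aQ*_μQ_μ)A_μ⟩, formΔI A = Σ_μ η^d⟨A_μ, (Δ + 1)A_μ⟩;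
§3 comparison lemmas: every diagonal entry at a source is ≤ the matching entry of the scalar member (torus, μ) at a row /
   the source itself, and every scalar L² member is ≤ a sum over ν of diagonal members at SLOTTED sources;
§4 families `famDiag`, `famDiagTop d L a m²` (index `B5ResidualGpTorusHolds.TopIdx`), reindexing, and THE ASSEMBLY:
   **`prop12_diag_of_scalar`**: Prop12Printed (scalar family over (torus, μ)) → Local114Fam (diag family) → Prop12Printed
   (diag family) (δ₀ ↦ min, constants ↦ max(·, 0) / max); **`local114_scalar_of_diag`**: Local114Fam (diag) → Local114Fam
   (scalar) (constant (d + 1)·C); hence **`prop12Diag_top (h11G0 : Prop11Printed (famG0Top d L a m²))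
   (h114 : Local114Fam (famDiagTop d L a m²)) : Prop12Printed (famDiagTop d L a m²)`** — with r02's
   `B5Prop11G0Tower.prop11Printed_famG0Top` the only remaining input for Prop. 1.2 of the diagonal G₀ on the torus is
   «(1.114) for G₀» («This leads also to (1.114) by the same reasoning with a random walk expansion as for G», p. 39).
HONEST SCOPE: U = 1; tori of `Setup`; the scalar family's DIVERGENCE T (h1 := 0 for α > 1) is harmless here (Prop. 1.2
reads 0 ≤ α < 1) and `g0Diag` itself is NOT truncated; constants explicit, not optimised.  CELL BOOK-KEEPING: row
B5.Prop1.2 census (vii) → the (1.132) hand-over (r02 DESIGN NOTE 2, 2026-08-21); VALUE = typing + bookkeeping, NOT summit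
progress.
-/

namespace Literature.MathematicalPhysics.QuantumFieldTheory.Balaban1983to89

open Matrix

noncomputable section

namespace B5G0DiagTorus

open B1RG242Torus B5Ineq137Torus B5GpSettingTorus B5Eq133G0Torus B5G0SettingTorus B5FromB4 B5TowerSourcesG0

variable {P : Params}

/-! ## §1 Sources of three kinds (`B5TowerSourcesG0.LocT`), Hölder norms of families, the diagonal kernels -/

/-- **The row of a tensor source feeding the component μ**: (T_{νμ})_ν. [cite: Balaban1984PropagatorsI, (1.89) p.33, p.21 («∂*A = Σ_μ ∂*_μA_μ»)] -/
def row (T : Fin P.d → Fin P.d → Site P 0 → ℝ) (μ : Fin P.d) : Fin P.d → Site P 0 → ℝ := fun ν => T ν μ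

variable (P) in
/-- **Hölder norm of a finite family of scalar functions**: max_i ‖F_i‖_ε ((1.109) for any index set).
[cite: Balaban1984PropagatorsI, (1.109) p.35] -/
def holG (k : ℕ) (ε : ℝ) {ι : Type} [Fintype ι] (i₀ : ι) (F : ι → Site P 0 → ℝ) : ℝ :=
  (Finset.univ : Finset ι).sup' ⟨i₀, Finset.mem_univ _⟩ (fun i => holN P k ε (F i))

/-- ‖F_i‖_ε ≤ ‖F‖_ε. [cite: Balaban1984PropagatorsI, (1.109) p.35] -/
theorem le_holG (k : ℕ) (ε : ℝ) {ι : Type} [Fintype ι] (i₀ : ι) (F : ι → Site P 0 → ℝ) (i : ι) :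
    holN P k ε (F i) ≤ holG P k ε i₀ F :=
  Finset.le_sup' (fun i => holN P k ε (F i)) (Finset.mem_univ i)

/-- ‖F‖_ε ≥ 0. [cite: Balaban1984PropagatorsI, (1.109) p.35] -/
theorem holG_nonneg (k : ℕ) (ε : ℝ) {ι : Type} [Fintype ι] (i₀ : ι) (F : ι → Site P 0 → ℝ) : 0 ≤ holG P k ε i₀ F :=
  (holN_nonneg P k ε (F i₀)).trans (le_holG k ε i₀ F i₀)

/-- The vector Hölder norm is `holG` (definitional). [cite: Balaban1984PropagatorsI, (1.109) p.35] -/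
theorem holderV_eq_holG (k : ℕ) (ε : ℝ) (A : Fin P.d → Site P 0 → ℝ) : holderV P k ε A = holG P k ε (dir0 P) A := rfl

section Kernels

variable (P) (a msq : ℝ) (k : ℕ)

/-- **(G₀A)_μ(x) = (G₀^{(μ)}A_μ)(x)** — G₀ is diagonal in vector indices. [cite: Balaban1984PropagatorsI, (1.132) p.39] -/
def dK0 (A : Fin P.d → Site P 0 → ℝ) (μ : Fin P.d) (x : Site P 0) : ℝ := opK0 P (G0 P a msq k μ) (A μ) x

/-- **(∇G₀A)_{λμ}(x) = (∂_λG₀^{(μ)}A_μ)(x)**, index p = (λ, μ). [cite: Balaban1984PropagatorsI, (1.110) p.35, (1.132) p.39] -/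
def dKD (A : Fin P.d → Site P 0 → ℝ) (p : Fin P.d × Fin P.d) (x : Site P 0) : ℝ :=
  opKD P k (G0 P a msq k p.2) p.1 (A p.2) x

/-- **(ΔG₀A)_μ(x)**. [cite: Balaban1984PropagatorsI, (1.110) p.35, (1.132) p.39] -/
def dKL (A : Fin P.d → Site P 0 → ℝ) (μ : Fin P.d) (x : Site P 0) : ℝ := opKL P k (G0 P a msq k μ) (A μ) x

/-- **(∇∇G₀A)_{(λλ′)μ}(x) = (∂_λ∂_{λ′}G₀^{(μ)}A_μ)(x)**. [cite: Balaban1984PropagatorsI, (1.89) p.33, (1.114) p.36] -/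
def dKD2 (A : Fin P.d → Site P 0 → ℝ) (p : (Fin P.d × Fin P.d) × Fin P.d) (x : Site P 0) : ℝ :=
  opKD2 P k (G0 P a msq k p.2) p.1.1 p.1.2 (A p.2) x

/-- **(G₀∇*T)_μ(x) = (G₀^{(μ)}Σ_ν∂*_νT_{νμ})(x)**. [cite: Balaban1984PropagatorsI, (1.110) p.35, (1.132) p.39] -/
def dDiv (T : Fin P.d → Fin P.d → Site P 0 → ℝ) (μ : Fin P.d) (x : Site P 0) : ℝ :=
  opDiv P k (G0 P a msq k μ) (row T μ) x

/-- **(∇G₀∇*T)_{λμ}(x)**, index p = (λ, μ). [cite: Balaban1984PropagatorsI, (1.112) p.36, (1.132) p.39] -/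
def dDD (T : Fin P.d → Fin P.d → Site P 0 → ℝ) (p : Fin P.d × Fin P.d) (x : Site P 0) : ℝ :=
  opDD P k (G0 P a msq k p.2) (row T p.2) p.1 x

/-- **(G₀∇*∇*T)_μ(x) = (G₀^{(μ)}Σ_{(ν,ν′)}∂*_ν∂*_{ν′}T_{(νν′)μ})(x)** (the sixth member of (1.89)/(1.114)).
[cite: Balaban1984PropagatorsI, (1.89) p.33, (1.114) p.36] -/
def dDiv2 (T : Fin P.d × Fin P.d → Fin P.d → Site P 0 → ℝ) (μ : Fin P.d) (x : Site P 0) : ℝ :=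
  (G0 P a msq k μ *ᵥ (∑ p : Fin P.d × Fin P.d, (dEta P k p.1)ᵀ *ᵥ ((dEta P k p.2)ᵀ *ᵥ T p μ))) x

/-! ## §2 The diagonal setting `g0Diag` -/

/-- **‖J‖_ε** (1.109), kind by kind. [cite: Balaban1984PropagatorsI, (1.109) p.35] -/
def holder3 (ε : ℝ) : LocT P → ℝ
  | .vec A => holderV P k ε A
  | .ten T => holG P k ε (dir0 P, dir0 P) (fun p : Fin P.d × Fin P.d => T p.1 p.2)
  | .ten2 T => holG P k ε ((dir0 P, dir0 P), dir0 P) (fun p : (Fin P.d × Fin P.d) × Fin P.d => T p.1 p.2)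

/-- **(1.110)** kind by kind: vec ↦ (|G₀A|, |∇G₀A|, 0, |ΔG₀A|), ten ↦ (0, 0, |G₀∇*T|, 0), ten2 ↦ 0 — sups over Δ̃(y).
[cite: Balaban1984PropagatorsI, (1.110) p.35] -/
def e3 (m : Fin 4) : LocT P → Site P k → ℝ
  | .vec A, y => (![cubeSup P k y (dir0 P) (dK0 P a msq k A), cubeSup P k y (dir0 P, dir0 P) (dKD P a msq k A), 0,
      cubeSup P k y (dir0 P) (dKL P a msq k A)] : Fin 4 → ℝ) m
  | .ten T, y => (![0, 0, cubeSup P k y (dir0 P) (dDiv P a msq k T), 0] : Fin 4 → ℝ) m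
  | .ten2 _, _ => 0

/-- **(1.111)** kind by kind: vec ↦ ‖ζ∇G₀A‖_α, ten ↦ ‖ζG₀∇*T‖_α, ten2 ↦ 0. [cite: Balaban1984PropagatorsI, (1.111) p.35] -/
def h13 : LocT P → ℝ → (Site P 0 → ℝ) → ℝ
  | .vec A, α, ζ => holG P k α (dir0 P, dir0 P) (fun p x => ζ x * dKD P a msq k A p x)
  | .ten T, α, ζ => holG P k α (dir0 P) (fun μ x => ζ x * dDiv P a msq k T μ x)
  | .ten2 _, _, _ => 0

/-- **(1.112)**: ten ↦ |∇G₀∇*T| over Δ̃(y); 0 on the other kinds. [cite: Balaban1984PropagatorsI, (1.112) p.36] -/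
def e43 : LocT P → Site P k → ℝ
  | .ten T, y => cubeSup P k y (dir0 P, dir0 P) (dDD P a msq k T)
  | .vec _, _ => 0
  | .ten2 _, _ => 0

/-- **(1.113)**: ten ↦ ‖ζ∇G₀∇*T‖_α; 0 on the other kinds. [cite: Balaban1984PropagatorsI, (1.113) p.36] -/
def h23 : LocT P → ℝ → (Site P 0 → ℝ) → ℝ
  | .ten T, α, ζ => holG P k α (dir0 P, dir0 P) (fun p x => ζ x * dDD P a msq k T p x)
  | .vec _, _, _ => 0
  | .ten2 _, _, _ => 0

/-- **(1.114)** kind by kind: vec ↦ (‖ζG₀A‖, ‖ζ∇G₀A‖, 0, 0, ‖ζ∇∇G₀A‖, 0), ten ↦ (0, 0, ‖ζG₀∇*T‖, ‖ζ∇G₀∇*T‖, 0, 0),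
ten2 ↦ (0, 0, 0, 0, 0, ‖ζG₀∇*∇*T‖). [cite: Balaban1984PropagatorsI, (1.114) p.36] -/
def l2loc3 (m : Fin 6) : LocT P → (Site P 0 → ℝ) → ℝ
  | .vec A, ζ => (![l2Fam P k (fun μ x => ζ x * dK0 P a msq k A μ x),
      l2Fam P k (fun (p : Fin P.d × Fin P.d) x => ζ x * dKD P a msq k A p x), 0, 0,
      l2Fam P k (fun (p : (Fin P.d × Fin P.d) × Fin P.d) x => ζ x * dKD2 P a msq k A p x), 0] : Fin 6 → ℝ) m
  | .ten T, ζ => (![0, 0, l2Fam P k (fun μ x => ζ x * dDiv P a msq k T μ x),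
      l2Fam P k (fun (p : Fin P.d × Fin P.d) x => ζ x * dDD P a msq k T p x), 0, 0] : Fin 6 → ℝ) m
  | .ten2 T, ζ => (![0, 0, 0, 0, 0, l2Fam P k (fun μ x => ζ x * dDiv2 P a msq k T μ x)] : Fin 6 → ℝ) m

/-- **(1.89)** kind by kind: the members of (1.114) with ζ = 1. [cite: Balaban1984PropagatorsI, Prop. 1.1 (1.89) p.33] -/
def l2op3 (m : Fin 6) (J : LocT P) : ℝ := l2loc3 P a msq k m J (fun _ => 1)

/-- **THE DIAGONAL G₀-SETTING**: Bałaban's G₀ = (Δ + aQ*Q)⁻¹ = ⊕_μ G₀^{(μ)} on 1-forms of ONE torus at level k as a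
`B5.Setting` — sites T₁^{(k)}, sources of the three kinds, the Prop-1.2 fields kind by kind (mirroring the lattice setting
of G), the L² half, and the forms of (1.90) summed over components. [cite: Balaban1984PropagatorsI, (1.132) p.39, Prop. 1.1 (1.89)–(1.90) p.33, Prop. 1.2 (1.108)–(1.114) pp.35–36] -/
def g0Diag : B5.Setting where
  Site := Site P k
  dist := T P k
  k := k
  Loc := LocT P
  suppIn := suppInT P k
  supNorm := supNormT P
  l2Norm := l2NormT P k
  holder := holder3 P k
  Cut := Site P 0 → ℝ
  cutIn := fun ζ y => ∀ x, ζ x ≠ 0 → inCube P k x y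
  cutH := cutHV P k
  cutSup := supN P
  l2op := l2op3 P a msq k
  e := e3 P a msq k
  h1 := h13 P a msq k
  e4 := e43 P a msq k
  h2 := h23 P a msq k
  l2loc := l2loc3 P a msq k
  Vec := Fin P.d → Site P 0 → ℝ
  formΔa := fun A => ∑ μ, formOp P k (M0 P a msq k μ) (A μ)
  formΔI := fun A => ∑ μ, formOp P k (lapEta P k + 1) (A μ)

end Kernels

/-! ## §3 Comparison with the scalar members (torus, μ) -/

section Compare

variable {a msq : ℝ} {k : ℕ}

/-- supports of rows. [cite: Balaban1984PropagatorsI, (1.110) p.35] -/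
theorem suppIn_row {T : Fin P.d → Fin P.d → Site P 0 → ℝ} {y' : Site P k}
    (hT : ∀ ν μ x, T ν μ x ≠ 0 → inCube P k x y') (μ : Fin P.d) : ∀ ν x, row T μ ν x ≠ 0 → inCube P k x y' :=
  fun ν x h => hT ν μ x h

/-- |row_μ T| ≤ |T|. [cite: Balaban1984PropagatorsI, (1.108) p.35] -/
theorem supNormV_row_le (T : Fin P.d → Fin P.d → Site P 0 → ℝ) (μ : Fin P.d) :
    supNormV P (row T μ) ≤ supNormT P (.ten T) :=
  Finset.sup'_le _ _ fun ν _ => (supN_le_supNormV (T ν) μ).trans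
    (Finset.le_sup' (fun ν => supNormV P (T ν)) (Finset.mem_univ ν))

/-- ‖row_μ T‖_ε ≤ ‖T‖_ε. [cite: Balaban1984PropagatorsI, (1.109) p.35] -/
theorem holderV_row_le (ε : ℝ) (T : Fin P.d → Fin P.d → Site P 0 → ℝ) (μ : Fin P.d) :
    holderV P k ε (row T μ) ≤ holG P k ε (dir0 P, dir0 P) (fun p : Fin P.d × Fin P.d => T p.1 p.2) :=
  Finset.sup'_le _ _ fun ν _ => le_holG k ε (dir0 P, dir0 P) (fun p : Fin P.d × Fin P.d => T p.1 p.2) (ν, μ)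

/-- The weight η^d ≥ 0. [folklore] -/
private theorem w_nonneg (k : ℕ) : 0 ≤ (((P.L : ℝ) ^ k)⁻¹) ^ P.d := by positivity

/-- ‖row_μ T‖ ≤ ‖T‖. [cite: Balaban1984PropagatorsI, (1.89) p.33] -/
theorem l2Fam_row_le (T : Fin P.d → Fin P.d → Site P 0 → ℝ) (μ : Fin P.d) :
    l2Fam P k (row T μ) ≤ l2Fam P k (fun p : Fin P.d × Fin P.d => T p.1 p.2) := by
  unfold l2Fam
  refine Real.sqrt_le_sqrt ?_
  rw [Fintype.sum_prod_type]
  refine Finset.sum_le_sum fun ν _ => ?_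
  exact Finset.single_le_sum (f := fun μ' => ∑ x, (((P.L : ℝ) ^ k)⁻¹) ^ P.d * (T ν μ' x) ^ 2)
    (fun μ' _ => Finset.sum_nonneg fun x _ => mul_nonneg (w_nonneg k) (sq_nonneg _)) (Finset.mem_univ μ)

/-- **|(G₀A)_μ(x)| ≤ the entry |G₀^{(μ)}A| of the scalar member μ**, x ∈ Δ̃(y). [cite: Balaban1984PropagatorsI, (1.110) p.35] -/
theorem dK0_le (A : Fin P.d → Site P 0 → ℝ) (μ : Fin P.d) {x : Site P 0} {y : Site P k} (hx : inCube P k x y) :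
    |dK0 P a msq k A μ x| ≤ (g0Setting P a msq k μ).e 0 A y :=
  le_cubeSup (dir0 P) (fun ν => opK0 P (G0 P a msq k μ) (A ν)) μ hx

/-- **|(∇G₀A)_{λμ}(x)| ≤ the entry |∇G₀^{(μ)}A| of the scalar member μ**. [cite: Balaban1984PropagatorsI, (1.110) p.35] -/
theorem dKD_le (A : Fin P.d → Site P 0 → ℝ) (p : Fin P.d × Fin P.d) {x : Site P 0} {y : Site P k} (hx : inCube P k x y) :
    |dKD P a msq k A p x| ≤ (g0Setting P a msq k p.2).e 1 A y :=
  le_cubeSup (dir0 P, dir0 P) (fun q : Fin P.d × Fin P.d => opKD P k (G0 P a msq k p.2) q.1 (A q.2)) p hx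

/-- **|(ΔG₀A)_μ(x)| ≤ the entry |ΔG₀^{(μ)}A| of the scalar member μ**. [cite: Balaban1984PropagatorsI, (1.110) p.35] -/
theorem dKL_le (A : Fin P.d → Site P 0 → ℝ) (μ : Fin P.d) {x : Site P 0} {y : Site P k} (hx : inCube P k x y) :
    |dKL P a msq k A μ x| ≤ (g0Setting P a msq k μ).e 3 A y :=
  le_cubeSup (dir0 P) (fun ν => opKL P k (G0 P a msq k μ) (A ν)) μ hx

/-- **|(G₀∇*T)_μ(x)| ≤ the entry |G₀^{(μ)}∇*row_μT| of the scalar member μ**. [cite: Balaban1984PropagatorsI, (1.110) p.35] -/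
theorem dDiv_le (T : Fin P.d → Fin P.d → Site P 0 → ℝ) (μ : Fin P.d) {x : Site P 0} {y : Site P k} (hx : inCube P k x y) :
    |dDiv P a msq k T μ x| ≤ (g0Setting P a msq k μ).e 2 (row T μ) y :=
  le_cubeSup () (fun _ : Unit => opDiv P k (G0 P a msq k μ) (row T μ)) () hx

/-- **|(∇G₀∇*T)_{λμ}(x)| ≤ the entry |∇G₀^{(μ)}∇*row_μT| of the scalar member μ**. [cite: Balaban1984PropagatorsI, (1.112) p.36] -/
theorem dDD_le (T : Fin P.d → Fin P.d → Site P 0 → ℝ) (p : Fin P.d × Fin P.d) {x : Site P 0} {y : Site P k}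
    (hx : inCube P k x y) : |dDD P a msq k T p x| ≤ (g0Setting P a msq k p.2).e4 (row T p.2) y :=
  le_cubeSup (dir0 P) (opDD P k (G0 P a msq k p.2) (row T p.2)) p.1 hx

/-- **‖ζ(∇G₀A)_{λμ}‖_α ≤ h1 of the scalar member μ at A** (α ≤ 1). [cite: Balaban1984PropagatorsI, (1.111) p.35] -/
theorem holN_dKD_le (A : Fin P.d → Site P 0 → ℝ) (p : Fin P.d × Fin P.d) {α : ℝ} (hα : α ≤ 1) (ζ : Site P 0 → ℝ) :
    holN P k α (fun x => ζ x * dKD P a msq k A p x) ≤ (g0Setting P a msq k p.2).h1 A α ζ := by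
  have h : (g0Setting P a msq k p.2).h1 A α ζ =
      max (opHD P k (G0 P a msq k p.2) A α ζ) (opHS P k (G0 P a msq k p.2) A α ζ) :=
    opSetting_h1_of_le (P := P) (k := k) (G := G0 P a msq k p.2) (Gi := M0 P a msq k p.2) A hα ζ
  rw [h]
  refine le_trans ?_ (le_max_left _ _)
  exact Finset.le_sup' (fun q : Fin P.d × Fin P.d =>
    holN P k α (fun x => ζ x * opKD P k (G0 P a msq k p.2) q.1 (A q.2) x)) (Finset.mem_univ p)

/-- **‖ζ(G₀∇*T)_μ‖_α ≤ h1 of the scalar member μ at row_μT** (α ≤ 1). [cite: Balaban1984PropagatorsI, (1.111) p.35] -/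
theorem holN_dDiv_le (T : Fin P.d → Fin P.d → Site P 0 → ℝ) (μ : Fin P.d) {α : ℝ} (hα : α ≤ 1) (ζ : Site P 0 → ℝ) :
    holN P k α (fun x => ζ x * dDiv P a msq k T μ x) ≤ (g0Setting P a msq k μ).h1 (row T μ) α ζ := by
  have h : (g0Setting P a msq k μ).h1 (row T μ) α ζ =
      max (opHD P k (G0 P a msq k μ) (row T μ) α ζ) (opHS P k (G0 P a msq k μ) (row T μ) α ζ) :=
    opSetting_h1_of_le (P := P) (k := k) (G := G0 P a msq k μ) (Gi := M0 P a msq k μ) (row T μ) hα ζ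
  rw [h]
  exact le_max_right _ _

/-- **‖ζ(∇G₀∇*T)_{λμ}‖_α ≤ h2 of the scalar member μ at row_μT**. [cite: Balaban1984PropagatorsI, (1.113) p.36] -/
theorem holN_dDD_le (T : Fin P.d → Fin P.d → Site P 0 → ℝ) (p : Fin P.d × Fin P.d) (α : ℝ) (ζ : Site P 0 → ℝ) :
    holN P k α (fun x => ζ x * dDD P a msq k T p x) ≤ (g0Setting P a msq k p.2).h2 (row T p.2) α ζ :=
  Finset.le_sup' (fun lam => holN P k α (fun x => ζ x * opDD P k (G0 P a msq k p.2) (row T p.2) lam x))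
    (Finset.mem_univ p.1)

/-! ### Slotted sources: the scalar L² members from the diagonal ones -/

/-- **A_ν slotted into component μ**: the vector source (0, …, A_ν, …, 0). [cite: Balaban1984PropagatorsI, (1.114) p.36] -/
def slot (A : Fin P.d → Site P 0 → ℝ) (ν μ : Fin P.d) : Fin P.d → Site P 0 → ℝ :=
  fun μ' => if μ' = μ then A ν else fun _ => 0

/-- **A slotted into the rows feeding component μ**: the tensor source with row_μ = A, other rows 0.
[cite: Balaban1984PropagatorsI, (1.114) p.36] -/
def tslot (A : Fin P.d → Site P 0 → ℝ) (μ : Fin P.d) : Fin P.d → Fin P.d → Site P 0 → ℝ :=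
  fun ν μ' => if μ' = μ then A ν else fun _ => 0

/-- slot at μ. [folklore] -/
private theorem slot_self (A : Fin P.d → Site P 0 → ℝ) (ν μ : Fin P.d) : slot A ν μ μ = A ν := by simp [slot]

/-- row_μ of the tensor slot is A. [folklore] -/
private theorem row_tslot (A : Fin P.d → Site P 0 → ℝ) (μ : Fin P.d) : row (tslot A μ) μ = A := by
  funext ν; simp [row, tslot]

/-- supports of slots. [cite: Balaban1984PropagatorsI, (1.114) p.36] -/
theorem suppIn_slot {A : Fin P.d → Site P 0 → ℝ} {y' : Site P k} (hA : ∀ ν x, A ν x ≠ 0 → inCube P k x y')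
    (ν μ : Fin P.d) : ∀ μ' x, slot A ν μ μ' x ≠ 0 → inCube P k x y' := by
  intro μ' x h
  unfold slot at h
  split_ifs at h with hμ
  · exact hA ν x h
  · exact absurd rfl h

/-- supports of tensor slots. [cite: Balaban1984PropagatorsI, (1.114) p.36] -/
theorem suppIn_tslot {A : Fin P.d → Site P 0 → ℝ} {y' : Site P k} (hA : ∀ ν x, A ν x ≠ 0 → inCube P k x y')
    (μ : Fin P.d) : ∀ ν μ' x, tslot A μ ν μ' x ≠ 0 → inCube P k x y' := by
  intro ν μ' x h
  unfold tslot at h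
  split_ifs at h with hμ
  · exact hA ν x h
  · exact absurd rfl h

/-- ‖slot_{ν→μ}A‖ ≤ ‖A‖. [cite: Balaban1984PropagatorsI, (1.89) p.33] -/
theorem l2Fam_slot_le (A : Fin P.d → Site P 0 → ℝ) (ν μ : Fin P.d) : l2Fam P k (slot A ν μ) ≤ l2Fam P k A := by
  unfold l2Fam
  refine Real.sqrt_le_sqrt ?_
  have h : ∀ μ', ∑ x, (((P.L : ℝ) ^ k)⁻¹) ^ P.d * (slot A ν μ μ' x) ^ 2 =
      if μ' = μ then ∑ x, (((P.L : ℝ) ^ k)⁻¹) ^ P.d * (A ν x) ^ 2 else 0 := by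
    intro μ'
    unfold slot
    split_ifs <;> simp
  simp_rw [h]
  rw [Finset.sum_ite_eq' Finset.univ μ, if_pos (Finset.mem_univ _)]
  exact Finset.single_le_sum (f := fun ν' => ∑ x, (((P.L : ℝ) ^ k)⁻¹) ^ P.d * (A ν' x) ^ 2)
    (fun ν' _ => Finset.sum_nonneg fun x _ => mul_nonneg (w_nonneg k) (sq_nonneg _)) (Finset.mem_univ ν)

/-- ‖tslot_μA‖ ≤ ‖A‖. [cite: Balaban1984PropagatorsI, (1.89) p.33] -/
theorem l2Fam_tslot_le (A : Fin P.d → Site P 0 → ℝ) (μ : Fin P.d) :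
    l2Fam P k (fun p : Fin P.d × Fin P.d => tslot A μ p.1 p.2) ≤ l2Fam P k A := by
  unfold l2Fam
  refine Real.sqrt_le_sqrt ?_
  rw [Fintype.sum_prod_type]
  refine Finset.sum_le_sum fun ν _ => ?_
  have h : ∀ μ', ∑ x, (((P.L : ℝ) ^ k)⁻¹) ^ P.d * (tslot A μ ν μ' x) ^ 2 =
      if μ' = μ then ∑ x, (((P.L : ℝ) ^ k)⁻¹) ^ P.d * (A ν x) ^ 2 else 0 := by
    intro μ'
    unfold tslot
    split_ifs <;> simp
  simp_rw [h]
  rw [Finset.sum_ite_eq' Finset.univ μ, if_pos (Finset.mem_univ _)]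

/-- √(Σ_ν g_ν) ≤ Σ_ν D_ν when 0 ≤ g_ν ≤ D_ν², D_ν ≥ 0. [folklore] -/
private theorem sqrt_sum_le {ι : Type} [Fintype ι] (g D : ι → ℝ) (hD : ∀ i, 0 ≤ D i) (h : ∀ i, g i ≤ D i ^ 2) :
    Real.sqrt (∑ i, g i) ≤ ∑ i, D i := by
  have hS : 0 ≤ ∑ i, D i := Finset.sum_nonneg fun i _ => hD i
  have hle : ∑ i, g i ≤ (∑ i, D i) ^ 2 :=
    calc ∑ i, g i ≤ ∑ i, D i ^ 2 := Finset.sum_le_sum fun i _ => h i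
      _ = ∑ i, D i * D i := by simp [sq]
      _ ≤ ∑ i, D i * ∑ j, D j := Finset.sum_le_sum fun i _ =>
          mul_le_mul_of_nonneg_left (Finset.single_le_sum (f := D) (fun j _ => hD j) (Finset.mem_univ i)) (hD i)
      _ = (∑ i, D i) ^ 2 := by rw [sq, Finset.sum_mul]
  calc Real.sqrt (∑ i, g i) ≤ Real.sqrt ((∑ i, D i) ^ 2) := Real.sqrt_le_sqrt hle
    _ = ∑ i, D i := Real.sqrt_sq hS

/-- **‖ζG₀^{(μ)}A‖ (scalar member 0 at A) ≤ Σ_ν ‖ζG₀ slot_{ν→μ}A‖ (diagonal member 0)**. [cite: Balaban1984PropagatorsI, (1.114) p.36] -/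
theorem scalar_l2loc0_le (A : Fin P.d → Site P 0 → ℝ) (μ : Fin P.d) (ζ : Site P 0 → ℝ) :
    (g0Setting P a msq k μ).l2loc 0 A ζ ≤ ∑ ν, (g0Diag P a msq k).l2loc 0 (.vec (slot A ν μ)) ζ := by
  show l2Fam P k (fun ν x => ζ x * (G0 P a msq k μ *ᵥ A ν) x) ≤
    ∑ ν, l2Fam P k (fun μ' x => ζ x * dK0 P a msq k (slot A ν μ) μ' x)
  unfold l2Fam
  refine sqrt_sum_le _ _ (fun ν => Real.sqrt_nonneg _) fun ν => ?_
  rw [Real.sq_sqrt (Finset.sum_nonneg fun μ' _ => Finset.sum_nonneg fun x _ => mul_nonneg (w_nonneg k) (sq_nonneg _))]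
  refine le_trans (le_of_eq ?_) (Finset.single_le_sum (f := fun μ' => ∑ x, (((P.L : ℝ) ^ k)⁻¹) ^ P.d *
    (ζ x * dK0 P a msq k (slot A ν μ) μ' x) ^ 2)
    (fun μ' _ => Finset.sum_nonneg fun x _ => mul_nonneg (w_nonneg k) (sq_nonneg _)) (Finset.mem_univ μ))
  simp only [dK0, opK0, slot_self]

/-- **‖ζ∇G₀^{(μ)}A‖ (scalar member 1) ≤ Σ_ν ‖ζ∇G₀ slot_{ν→μ}A‖ (diagonal member 1)**. [cite: Balaban1984PropagatorsI, (1.114) p.36] -/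
theorem scalar_l2loc1_le (A : Fin P.d → Site P 0 → ℝ) (μ : Fin P.d) (ζ : Site P 0 → ℝ) :
    (g0Setting P a msq k μ).l2loc 1 A ζ ≤ ∑ ν, (g0Diag P a msq k).l2loc 1 (.vec (slot A ν μ)) ζ := by
  show l2Fam P k (fun (p : Fin P.d × Fin P.d) x => ζ x * ((dEta P k p.1 * G0 P a msq k μ) *ᵥ A p.2) x) ≤
    ∑ ν, l2Fam P k (fun (p : Fin P.d × Fin P.d) x => ζ x * dKD P a msq k (slot A ν μ) p x)
  unfold l2Fam
  rw [Fintype.sum_prod_type_right]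
  refine sqrt_sum_le _ _ (fun ν => Real.sqrt_nonneg _) fun ν => ?_
  rw [Real.sq_sqrt (Finset.sum_nonneg fun p _ => Finset.sum_nonneg fun x _ => mul_nonneg (w_nonneg k) (sq_nonneg _)),
    Fintype.sum_prod_type]
  refine Finset.sum_le_sum fun lam _ => ?_
  refine le_trans (le_of_eq ?_) (Finset.single_le_sum (f := fun μ' => ∑ x, (((P.L : ℝ) ^ k)⁻¹) ^ P.d *
    (ζ x * dKD P a msq k (slot A ν μ) (lam, μ') x) ^ 2)
    (fun μ' _ => Finset.sum_nonneg fun x _ => mul_nonneg (w_nonneg k) (sq_nonneg _)) (Finset.mem_univ μ))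
  simp only [dKD, opKD, slot_self]

/-- **‖ζ∇∇G₀^{(μ)}A‖ (scalar member 4) ≤ Σ_ν ‖ζ∇∇G₀ slot_{ν→μ}A‖ (diagonal member 4)**. [cite: Balaban1984PropagatorsI, (1.114) p.36] -/
theorem scalar_l2loc4_le (A : Fin P.d → Site P 0 → ℝ) (μ : Fin P.d) (ζ : Site P 0 → ℝ) :
    (g0Setting P a msq k μ).l2loc 4 A ζ ≤ ∑ ν, (g0Diag P a msq k).l2loc 4 (.vec (slot A ν μ)) ζ := by
  show l2Fam P k (fun (p : (Fin P.d × Fin P.d) × Fin P.d) x =>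
      ζ x * ((dEta P k p.1.1 * dEta P k p.1.2 * G0 P a msq k μ) *ᵥ A p.2) x) ≤
    ∑ ν, l2Fam P k (fun (p : (Fin P.d × Fin P.d) × Fin P.d) x => ζ x * dKD2 P a msq k (slot A ν μ) p x)
  unfold l2Fam
  rw [Fintype.sum_prod_type_right]
  refine sqrt_sum_le _ _ (fun ν => Real.sqrt_nonneg _) fun ν => ?_
  rw [Real.sq_sqrt (Finset.sum_nonneg fun p _ => Finset.sum_nonneg fun x _ => mul_nonneg (w_nonneg k) (sq_nonneg _)),
    Fintype.sum_prod_type (f := fun p : (Fin P.d × Fin P.d) × Fin P.d =>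
      ∑ x, (((P.L : ℝ) ^ k)⁻¹) ^ P.d * (ζ x * dKD2 P a msq k (slot A ν μ) p x) ^ 2)]
  refine Finset.sum_le_sum fun q _ => ?_
  refine le_trans (le_of_eq ?_) (Finset.single_le_sum (f := fun μ' => ∑ x, (((P.L : ℝ) ^ k)⁻¹) ^ P.d *
    (ζ x * dKD2 P a msq k (slot A ν μ) (q, μ') x) ^ 2)
    (fun μ' _ => Finset.sum_nonneg fun x _ => mul_nonneg (w_nonneg k) (sq_nonneg _)) (Finset.mem_univ μ))
  simp only [dKD2, opKD2, slot_self]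

/-- **‖ζG₀^{(μ)}∇*A‖ (scalar member 2 at A) ≤ ‖ζG₀∇* tslot_μA‖ (diagonal member 2)**. [cite: Balaban1984PropagatorsI, (1.114) p.36] -/
theorem scalar_l2loc2_le (A : Fin P.d → Site P 0 → ℝ) (μ : Fin P.d) (ζ : Site P 0 → ℝ) :
    (g0Setting P a msq k μ).l2loc 2 A ζ ≤ (g0Diag P a msq k).l2loc 2 (.ten (tslot A μ)) ζ := by
  show l2Fam P k (fun (_ : Unit) x => ζ x * opDiv P k (G0 P a msq k μ) A x) ≤
    l2Fam P k (fun μ' x => ζ x * dDiv P a msq k (tslot A μ) μ' x)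
  unfold l2Fam
  refine Real.sqrt_le_sqrt ?_
  rw [Fintype.sum_unique]
  refine le_trans (le_of_eq ?_) (Finset.single_le_sum (f := fun μ' => ∑ x, (((P.L : ℝ) ^ k)⁻¹) ^ P.d *
    (ζ x * dDiv P a msq k (tslot A μ) μ' x) ^ 2)
    (fun μ' _ => Finset.sum_nonneg fun x _ => mul_nonneg (w_nonneg k) (sq_nonneg _)) (Finset.mem_univ μ))
  simp only [dDiv, row_tslot]

/-- **‖ζ∇G₀^{(μ)}∇*A‖ (scalar member 3 at A) ≤ ‖ζ∇G₀∇* tslot_μA‖ (diagonal member 3)**. [cite: Balaban1984PropagatorsI, (1.114) p.36] -/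
theorem scalar_l2loc3_le (A : Fin P.d → Site P 0 → ℝ) (μ : Fin P.d) (ζ : Site P 0 → ℝ) :
    (g0Setting P a msq k μ).l2loc 3 A ζ ≤ (g0Diag P a msq k).l2loc 3 (.ten (tslot A μ)) ζ := by
  show l2Fam P k (fun lam x => ζ x * opDD P k (G0 P a msq k μ) A lam x) ≤
    l2Fam P k (fun (p : Fin P.d × Fin P.d) x => ζ x * dDD P a msq k (tslot A μ) p x)
  unfold l2Fam
  refine Real.sqrt_le_sqrt ?_
  rw [Fintype.sum_prod_type]
  refine Finset.sum_le_sum fun lam _ => ?_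
  refine le_trans (le_of_eq ?_) (Finset.single_le_sum (f := fun μ' => ∑ x, (((P.L : ℝ) ^ k)⁻¹) ^ P.d *
    (ζ x * dDD P a msq k (tslot A μ) (lam, μ') x) ^ 2)
    (fun μ' _ => Finset.sum_nonneg fun x _ => mul_nonneg (w_nonneg k) (sq_nonneg _)) (Finset.mem_univ μ))
  simp only [dDD, row_tslot]

end Compare

/-! ## §4 Families and the diagonal assembly -/

section NonnegFields

variable (a msq : ℝ) (k : ℕ)

/-- ‖J‖_ε ≥ 0 for every kind. [cite: Balaban1984PropagatorsI, (1.109) p.35] -/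
theorem holder3_nonneg (ε : ℝ) (J : LocT P) : 0 ≤ holder3 P k ε J := by
  cases J with
  | vec A => exact holderV_nonneg k ε A
  | ten T => exact holG_nonneg k ε (dir0 P, dir0 P) _
  | ten2 T => exact holG_nonneg k ε ((dir0 P, dir0 P), dir0 P) _

end NonnegFields

/-- A bound `C e^{−δ₀t} s` is monotone in (C, −δ₀) for t, s ≥ 0, C′ ≥ 0. [folklore] -/
private theorem bound_mono {C C' δ δ₀ t s : ℝ} (hC : C ≤ C') (hC' : 0 ≤ C') (hδ : δ ≤ δ₀) (ht : 0 ≤ t) (hs : 0 ≤ s) :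
    C * Real.exp (-(δ₀ * t)) * s ≤ C' * Real.exp (-(δ * t)) * s := by
  have he : Real.exp (-(δ₀ * t)) ≤ Real.exp (-(δ * t)) :=
    Real.exp_le_exp.mpr (neg_le_neg (mul_le_mul_of_nonneg_right hδ ht))
  have h1 : C * Real.exp (-(δ₀ * t)) ≤ C' * Real.exp (-(δ₀ * t)) :=
    mul_le_mul_of_nonneg_right hC (Real.exp_pos _).le
  have h2 : C' * Real.exp (-(δ₀ * t)) ≤ C' * Real.exp (-(δ * t)) := mul_le_mul_of_nonneg_left he hC'
  exact mul_le_mul_of_nonneg_right (h1.trans h2) hs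

/-- The same with an extra non-negative middle factor (the cut-off factor of (1.111)/(1.113)/(1.114)). [folklore] -/
private theorem bound_mono' {C C' δ δ₀ t u s : ℝ} (hC : C ≤ C') (hC' : 0 ≤ C') (hδ : δ ≤ δ₀) (ht : 0 ≤ t)
    (hu : 0 ≤ u) (hs : 0 ≤ s) :
    C * Real.exp (-(δ₀ * t)) * u * s ≤ C' * Real.exp (-(δ * t)) * u * s := by
  have h := bound_mono (s := u * s) hC hC' hδ ht (mul_nonneg hu hs)
  simpa only [mul_assoc] using h

section Families

variable {I : Type} (Pf : I → Params) (a msq : ℝ)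

/-- **The scalar family over (torus, direction)**: member (i, μ) = `g0Setting (Pf i) a m² K μ` (`famG0` on the Σ-index).
Reading (ours, not printed): one projection G₀^{(μ)} of the diagonal G₀ applied to every component of the source;
p. 39 L16–17 prints «where G₀ = (Δ + aQ*Q)⁻¹. This operator is similar to G′, but with the different averaging operator.»
[cite: Balaban1984PropagatorsI, (1.132) p.39 L16–17] -/
def famScalar : (Σ i, Fin (Pf i).d) → B5.Setting := famG0 (fun j : (Σ i, Fin (Pf i).d) => Pf j.1) (fun j => j.2) a msq

/-- **The diagonal family over tori**: member i = `g0Diag (Pf i) a m² K`. [cite: Balaban1984PropagatorsI, (1.132) p.39] -/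
def famDiag : I → B5.Setting := fun i => g0Diag (Pf i) a msq (Pf i).K

/-- Prop. 1.2 is stable under reindexing a family. [cite: Balaban1984PropagatorsI, Prop. 1.2 pp.35–36; bookkeeping] -/
theorem prop12_reindex {I' : Type} (fam : I → B5.Setting) (φ : I' → I) (h : B5.Prop12Printed fam) :
    B5.Prop12Printed (fun j => fam (φ j)) := by
  obtain ⟨δ₀, C, Cα, Cε, Cαε, hδ, hC, h⟩ := h
  exact ⟨δ₀, C, Cα, Cε, Cαε, hδ, hC, fun j => h (φ j)⟩

/-- (1.114) is stable under reindexing a family. [cite: Balaban1984PropagatorsI, (1.114) p.36; bookkeeping] -/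
theorem local114_reindex {I' : Type} (fam : I → B5.Setting) (φ : I' → I) (h : B5.Local114Fam fam) :
    B5.Local114Fam (fun j => fam (φ j)) := by
  obtain ⟨δ₀, C, hδ, hC, h⟩ := h
  exact ⟨δ₀, C, hδ, hC, fun j => h (φ j)⟩

/-- **THE DIAGONAL ASSEMBLY, (1.110)–(1.113) half**: Proposition 1.2 for the diagonal G₀ on every torus of the family from
Proposition 1.2 for the scalar members (torus, μ) and (1.114) for the diagonal family — every diagonal entry at a source is
bounded by the matching scalar entry at a row (sup and Hölder norms of rows are ≤ those of the source); δ₀ ↦ min,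
constants ↦ max. [cite: Balaban1984PropagatorsI, Prop. 1.2 (1.110)–(1.114) pp.35–36, (1.132) p.39] -/
theorem prop12_diag_of_scalar (hS : B5.Prop12Printed (famScalar Pf a msq)) (hL : B5.Local114Fam (famDiag Pf a msq)) :
    B5.Prop12Printed (famDiag Pf a msq) := by
  obtain ⟨δ₀, C, Cα, Cε, Cαε, hδ₀, hC, hS⟩ := hS
  obtain ⟨δ₁, C₁, hδ₁, hC₁, hL⟩ := hL
  have hCC : 0 ≤ max C C₁ := le_max_of_le_left hC.le
  refine ⟨min δ₀ δ₁, max C C₁, fun α => max (Cα α) 0, fun ε => max (Cε ε) 0, fun α ε => max (Cαε α ε) 0,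
    lt_min hδ₀ hδ₁, lt_max_of_lt_left hC, fun i => ⟨?_, ?_, ?_, ?_, ?_⟩⟩
  · -- (1.110)
    intro n J y y' hJ
    change LocT (Pf i) at J
    change Site (Pf i) (Pf i).K at y y'
    have ht : 0 ≤ T (Pf i) (Pf i).K y y' := T_nonneg (P := Pf i) (Pf i).K y y'
    cases J with
    | vec A =>
      have hA : ∀ ν x, A ν x ≠ 0 → inCube (Pf i) (Pf i).K x y' := hJ
      have key : ∀ (n' : Fin 4) (μ : Fin (Pf i).d), (g0Setting (Pf i) a msq (Pf i).K μ).e n' A y ≤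
          max C C₁ * Real.exp (-(min δ₀ δ₁ * T (Pf i) (Pf i).K y y')) * supNormV (Pf i) A := fun n' μ =>
        ((hS ⟨i, μ⟩).1 n' A y y' hA).trans
          (bound_mono (le_max_left _ _) hCC (min_le_left δ₀ δ₁) ht (supNormV_nonneg A))
      have h0 : 0 ≤ max C C₁ * Real.exp (-(min δ₀ δ₁ * T (Pf i) (Pf i).K y y')) * supNormV (Pf i) A :=
        mul_nonneg (mul_nonneg hCC (Real.exp_pos _).le) (supNormV_nonneg A)
      show e3 (Pf i) a msq (Pf i).K n (LocT.vec A) y ≤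
        max C C₁ * Real.exp (-(min δ₀ δ₁ * T (Pf i) (Pf i).K y y')) * supNormV (Pf i) A
      fin_cases n
      · show cubeSup (Pf i) (Pf i).K y (dir0 (Pf i)) (dK0 (Pf i) a msq (Pf i).K A) ≤ _
        exact cubeSup_le fun μ x hx => (dK0_le A μ hx).trans (key 0 μ)
      · show cubeSup (Pf i) (Pf i).K y (dir0 (Pf i), dir0 (Pf i)) (dKD (Pf i) a msq (Pf i).K A) ≤ _
        exact cubeSup_le fun p x hx => (dKD_le A p hx).trans (key 1 p.2)
      · exact h0
      · show cubeSup (Pf i) (Pf i).K y (dir0 (Pf i)) (dKL (Pf i) a msq (Pf i).K A) ≤ _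
        exact cubeSup_le fun μ x hx => (dKL_le A μ hx).trans (key 3 μ)
    | ten T' =>
      have hT : ∀ ν μ x, T' ν μ x ≠ 0 → inCube (Pf i) (Pf i).K x y' := hJ
      have h0 : 0 ≤ max C C₁ * Real.exp (-(min δ₀ δ₁ * T (Pf i) (Pf i).K y y')) *
          supNormT (Pf i) (LocT.ten T') :=
        mul_nonneg (mul_nonneg hCC (Real.exp_pos _).le) (supNormT_nonneg (Pf i) _)
      show e3 (Pf i) a msq (Pf i).K n (LocT.ten T') y ≤ max C C₁ * Real.exp (-(min δ₀ δ₁ * T (Pf i) (Pf i).K y y')) *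
        supNormT (Pf i) (LocT.ten T')
      fin_cases n
      · exact h0
      · exact h0
      · show cubeSup (Pf i) (Pf i).K y (dir0 (Pf i)) (dDiv (Pf i) a msq (Pf i).K T') ≤ _
        refine cubeSup_le fun μ x hx => (dDiv_le T' μ hx).trans ?_
        refine ((hS ⟨i, μ⟩).1 2 (row T' μ) y y' (suppIn_row hT μ)).trans ?_
        refine (bound_mono (le_max_left _ _) hCC (min_le_left δ₀ δ₁) ht (supNormV_nonneg _)).trans ?_
        exact mul_le_mul_of_nonneg_left (supNormV_row_le T' μ) (mul_nonneg hCC (Real.exp_pos _).le)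
      · exact h0
    | ten2 T' =>
      show (0 : ℝ) ≤ max C C₁ * Real.exp (-(min δ₀ δ₁ * T (Pf i) (Pf i).K y y')) *
        supNormT (Pf i) (LocT.ten2 T')
      exact mul_nonneg (mul_nonneg hCC (Real.exp_pos _).le) (supNormT_nonneg (Pf i) _)
  · -- (1.111)
    intro α J ζ y y' hα0 hα1 hζ hJ
    change LocT (Pf i) at J
    change Site (Pf i) 0 → ℝ at ζ
    change Site (Pf i) (Pf i).K at y y'
    have ht : 0 ≤ T (Pf i) (Pf i).K y y' := T_nonneg (P := Pf i) (Pf i).K y y'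
    have hc : 0 ≤ cutHV (Pf i) (Pf i).K α ζ := cutHV_nonneg _ α ζ
    have hCα : 0 ≤ max (Cα α) 0 := le_max_right _ _
    cases J with
    | vec A =>
      have hA : ∀ ν x, A ν x ≠ 0 → inCube (Pf i) (Pf i).K x y' := hJ
      show holG (Pf i) (Pf i).K α (dir0 (Pf i), dir0 (Pf i)) (fun p x => ζ x * dKD (Pf i) a msq (Pf i).K A p x) ≤
        max (Cα α) 0 * Real.exp (-(min δ₀ δ₁ * T (Pf i) (Pf i).K y y')) * cutHV (Pf i) (Pf i).K α ζ * supNormV (Pf i) A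
      refine Finset.sup'_le _ _ fun p _ => (holN_dKD_le A p hα1.le ζ).trans ?_
      exact ((hS ⟨i, p.2⟩).2.1 α A ζ y y' hα0 hα1 hζ hA).trans
        (bound_mono' (le_max_left _ _) hCα (min_le_left δ₀ δ₁) ht hc (supNormV_nonneg A))
    | ten T' =>
      have hT : ∀ ν μ x, T' ν μ x ≠ 0 → inCube (Pf i) (Pf i).K x y' := hJ
      show holG (Pf i) (Pf i).K α (dir0 (Pf i)) (fun μ x => ζ x * dDiv (Pf i) a msq (Pf i).K T' μ x) ≤
        max (Cα α) 0 * Real.exp (-(min δ₀ δ₁ * T (Pf i) (Pf i).K y y')) * cutHV (Pf i) (Pf i).K α ζ *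
          supNormT (Pf i) (LocT.ten T')
      refine Finset.sup'_le _ _ fun μ _ => (holN_dDiv_le T' μ hα1.le ζ).trans ?_
      refine ((hS ⟨i, μ⟩).2.1 α (row T' μ) ζ y y' hα0 hα1 hζ (suppIn_row hT μ)).trans ?_
      refine (bound_mono' (le_max_left _ _) hCα (min_le_left δ₀ δ₁) ht hc (supNormV_nonneg _)).trans ?_
      exact mul_le_mul_of_nonneg_left (supNormV_row_le T' μ) (mul_nonneg (mul_nonneg hCα (Real.exp_pos _).le) hc)
    | ten2 T' =>
      show (0 : ℝ) ≤ max (Cα α) 0 * Real.exp (-(min δ₀ δ₁ * T (Pf i) (Pf i).K y y')) * cutHV (Pf i) (Pf i).K α ζ *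
        supNormT (Pf i) (LocT.ten2 T')
      exact mul_nonneg (mul_nonneg (mul_nonneg hCα (Real.exp_pos _).le) hc) (supNormT_nonneg (Pf i) _)
  · -- (1.112)
    intro ε J y y' hε0 hε1 hJ
    change LocT (Pf i) at J
    change Site (Pf i) (Pf i).K at y y'
    have ht : 0 ≤ T (Pf i) (Pf i).K y y' := T_nonneg (P := Pf i) (Pf i).K y y'
    have hCε : 0 ≤ max (Cε ε) 0 := le_max_right _ _
    cases J with
    | vec A =>
      show (0 : ℝ) ≤ max (Cε ε) 0 * Real.exp (-(min δ₀ δ₁ * T (Pf i) (Pf i).K y y')) *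
        (holderV (Pf i) (Pf i).K ε A + supNormV (Pf i) A)
      exact mul_nonneg (mul_nonneg hCε (Real.exp_pos _).le) (add_nonneg (holderV_nonneg _ ε A) (supNormV_nonneg A))
    | ten T' =>
      have hT : ∀ ν μ x, T' ν μ x ≠ 0 → inCube (Pf i) (Pf i).K x y' := hJ
      show cubeSup (Pf i) (Pf i).K y (dir0 (Pf i), dir0 (Pf i)) (dDD (Pf i) a msq (Pf i).K T') ≤
        max (Cε ε) 0 * Real.exp (-(min δ₀ δ₁ * T (Pf i) (Pf i).K y y')) *
          (holG (Pf i) (Pf i).K ε (dir0 (Pf i), dir0 (Pf i)) (fun p : Fin (Pf i).d × Fin (Pf i).d => T' p.1 p.2) +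
            supNormT (Pf i) (LocT.ten T'))
      refine cubeSup_le fun p x hx => (dDD_le T' p hx).trans ?_
      refine ((hS ⟨i, p.2⟩).2.2.1 ε (row T' p.2) y y' hε0 hε1 (suppIn_row hT p.2)).trans ?_
      refine (bound_mono (le_max_left _ _) hCε (min_le_left δ₀ δ₁) ht
        (add_nonneg (holderV_nonneg _ ε _) (supNormV_nonneg _))).trans ?_
      exact mul_le_mul_of_nonneg_left (add_le_add (holderV_row_le ε T' p.2) (supNormV_row_le T' p.2))
        (mul_nonneg hCε (Real.exp_pos _).le)
    | ten2 T' =>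
      show (0 : ℝ) ≤ max (Cε ε) 0 * Real.exp (-(min δ₀ δ₁ * T (Pf i) (Pf i).K y y')) *
        (holG (Pf i) (Pf i).K ε ((dir0 (Pf i), dir0 (Pf i)), dir0 (Pf i))
            (fun p : (Fin (Pf i).d × Fin (Pf i).d) × Fin (Pf i).d => T' p.1 p.2) +
          supNormT (Pf i) (LocT.ten2 T'))
      exact mul_nonneg (mul_nonneg hCε (Real.exp_pos _).le) (add_nonneg (holG_nonneg _ _ _ _) (supNormT_nonneg (Pf i) _))
  · -- (1.113)
    intro α ε J ζ y y' hα0 hε0 hαε hζ hJ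
    change LocT (Pf i) at J
    change Site (Pf i) 0 → ℝ at ζ
    change Site (Pf i) (Pf i).K at y y'
    have ht : 0 ≤ T (Pf i) (Pf i).K y y' := T_nonneg (P := Pf i) (Pf i).K y y'
    have hc : 0 ≤ cutHV (Pf i) (Pf i).K α ζ := cutHV_nonneg _ α ζ
    have hCαε : 0 ≤ max (Cαε α ε) 0 := le_max_right _ _
    cases J with
    | vec A =>
      show (0 : ℝ) ≤ max (Cαε α ε) 0 * Real.exp (-(min δ₀ δ₁ * T (Pf i) (Pf i).K y y')) * cutHV (Pf i) (Pf i).K α ζ *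
        (holderV (Pf i) (Pf i).K (α + ε) A + supNormV (Pf i) A)
      exact mul_nonneg (mul_nonneg (mul_nonneg hCαε (Real.exp_pos _).le) hc)
        (add_nonneg (holderV_nonneg _ _ A) (supNormV_nonneg A))
    | ten T' =>
      have hT : ∀ ν μ x, T' ν μ x ≠ 0 → inCube (Pf i) (Pf i).K x y' := hJ
      show holG (Pf i) (Pf i).K α (dir0 (Pf i), dir0 (Pf i)) (fun p x => ζ x * dDD (Pf i) a msq (Pf i).K T' p x) ≤
        max (Cαε α ε) 0 * Real.exp (-(min δ₀ δ₁ * T (Pf i) (Pf i).K y y')) * cutHV (Pf i) (Pf i).K α ζ *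
          (holG (Pf i) (Pf i).K (α + ε) (dir0 (Pf i), dir0 (Pf i)) (fun p : Fin (Pf i).d × Fin (Pf i).d => T' p.1 p.2) +
            supNormT (Pf i) (LocT.ten T'))
      refine Finset.sup'_le _ _ fun p _ => (holN_dDD_le T' p α ζ).trans ?_
      refine ((hS ⟨i, p.2⟩).2.2.2.1 α ε (row T' p.2) ζ y y' hα0 hε0 hαε hζ (suppIn_row hT p.2)).trans ?_
      refine (bound_mono' (le_max_left _ _) hCαε (min_le_left δ₀ δ₁) ht hc
        (add_nonneg (holderV_nonneg _ _ _) (supNormV_nonneg _))).trans ?_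
      exact mul_le_mul_of_nonneg_left (add_le_add (holderV_row_le (α + ε) T' p.2) (supNormV_row_le T' p.2))
        (mul_nonneg (mul_nonneg hCαε (Real.exp_pos _).le) hc)
    | ten2 T' =>
      show (0 : ℝ) ≤ max (Cαε α ε) 0 * Real.exp (-(min δ₀ δ₁ * T (Pf i) (Pf i).K y y')) * cutHV (Pf i) (Pf i).K α ζ *
        (holG (Pf i) (Pf i).K (α + ε) ((dir0 (Pf i), dir0 (Pf i)), dir0 (Pf i))
            (fun p : (Fin (Pf i).d × Fin (Pf i).d) × Fin (Pf i).d => T' p.1 p.2) +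
          supNormT (Pf i) (LocT.ten2 T'))
      exact mul_nonneg (mul_nonneg (mul_nonneg hCαε (Real.exp_pos _).le) hc)
        (add_nonneg (holG_nonneg _ _ _ _) (supNormT_nonneg (Pf i) _))
  · -- (1.114): the hypothesis, constants relaxed
    intro n J ζ y y' hζ hJ
    change LocT (Pf i) at J
    change Site (Pf i) 0 → ℝ at ζ
    change Site (Pf i) (Pf i).K at y y'
    have ht : 0 ≤ T (Pf i) (Pf i).K y y' := T_nonneg (P := Pf i) (Pf i).K y y'
    refine (hL i n J ζ y y' hζ hJ).trans ?_
    exact bound_mono' (le_max_right _ _) hCC (min_le_right δ₀ δ₁) ht (supN_nonneg _ ζ) (l2NormT_nonneg (Pf i) (Pf i).K J)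

/-- **THE DIAGONAL ASSEMBLY, (1.114) half**: (1.114) for the scalar members (torus, μ) from (1.114) for the diagonal
family (P.d = d throughout) — the scalar member's ‖ζ·G₀^{(μ)}A‖-type norms are sums over ν of diagonal norms at the
slotted sources (0,…,A_ν,…,0) (members 0, 1, 4) or the diagonal norm at the tensor source with row_μ = A (members 2, 3);
the sixth scalar member is vacuous; constant (d + 1)·C. [cite: Balaban1984PropagatorsI, (1.114) p.36, (1.132) p.39] -/
theorem local114_scalar_of_diag {d : ℕ} (hPd : ∀ i, (Pf i).d = d) (hL : B5.Local114Fam (famDiag Pf a msq)) :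
    B5.Local114Fam (famScalar Pf a msq) := by
  obtain ⟨δ₁, C₁, hδ₁, hC₁, hL⟩ := hL
  refine ⟨δ₁, (d + 1) * C₁, hδ₁, by positivity, ?_⟩
  rintro ⟨i, μ⟩ n A ζ y y' hζ hA
  change Fin (Pf i).d → Site (Pf i) 0 → ℝ at A
  change Site (Pf i) 0 → ℝ at ζ
  change Site (Pf i) (Pf i).K at y y'
  have hA' : ∀ ν x, A ν x ≠ 0 → inCube (Pf i) (Pf i).K x y' := hA
  -- the common right-hand side and the per-slot bound
  set E := Real.exp (-(δ₁ * T (Pf i) (Pf i).K y y')) with hE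
  have hE0 : 0 ≤ E := (Real.exp_pos _).le
  have hz : 0 ≤ supN (Pf i) ζ := supN_nonneg _ ζ
  have hnA : 0 ≤ l2Fam (Pf i) (Pf i).K A := l2Fam_nonneg (P := Pf i) (Pf i).K A
  have hunit : C₁ * E * supN (Pf i) ζ * l2Fam (Pf i) (Pf i).K A ≤
      (d + 1) * C₁ * E * supN (Pf i) ζ * l2Fam (Pf i) (Pf i).K A := by
    have h1 : C₁ ≤ (d + 1) * C₁ := by nlinarith
    have := mul_le_mul_of_nonneg_right (mul_le_mul_of_nonneg_right (mul_le_mul_of_nonneg_right h1 hE0) hz) hnA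
    exact this
  have hsum : ∑ _ν : Fin (Pf i).d, C₁ * E * supN (Pf i) ζ * l2Fam (Pf i) (Pf i).K A ≤
      (d + 1) * C₁ * E * supN (Pf i) ζ * l2Fam (Pf i) (Pf i).K A := by
    rw [Finset.sum_const, Finset.card_univ, Fintype.card_fin, nsmul_eq_mul]
    have hdd : ((Pf i).d : ℝ) = d := by exact_mod_cast hPd i
    rw [hdd]
    have h0 : 0 ≤ C₁ * E * supN (Pf i) ζ * l2Fam (Pf i) (Pf i).K A :=
      mul_nonneg (mul_nonneg (mul_nonneg hC₁.le hE0) hz) hnA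
    nlinarith
  -- diagonal bounds at the slotted sources
  have hslot : ∀ (m : Fin 6) (ν : Fin (Pf i).d), (g0Diag (Pf i) a msq (Pf i).K).l2loc m (.vec (slot A ν μ)) ζ ≤
      C₁ * E * supN (Pf i) ζ * l2Fam (Pf i) (Pf i).K A := by
    intro m ν
    refine (hL i m (.vec (slot A ν μ)) ζ y y' hζ (suppIn_slot hA' ν μ)).trans ?_
    exact mul_le_mul_of_nonneg_left (l2Fam_slot_le A ν μ) (mul_nonneg (mul_nonneg hC₁.le hE0) hz)
  have htslot : ∀ m : Fin 6, (g0Diag (Pf i) a msq (Pf i).K).l2loc m (.ten (tslot A μ)) ζ ≤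
      C₁ * E * supN (Pf i) ζ * l2Fam (Pf i) (Pf i).K A := by
    intro m
    refine (hL i m (.ten (tslot A μ)) ζ y y' hζ (suppIn_tslot hA' μ)).trans ?_
    exact mul_le_mul_of_nonneg_left (l2Fam_tslot_le A μ) (mul_nonneg (mul_nonneg hC₁.le hE0) hz)
  show (g0Setting (Pf i) a msq (Pf i).K μ).l2loc n A ζ ≤ (d + 1) * C₁ * E * supN (Pf i) ζ * l2NormV (Pf i) (Pf i).K A
  rw [l2NormV_eq_l2Fam]
  fin_cases n
  · exact (scalar_l2loc0_le A μ ζ).trans ((Finset.sum_le_sum fun ν _ => hslot 0 ν).trans hsum)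
  · exact (scalar_l2loc1_le A μ ζ).trans ((Finset.sum_le_sum fun ν _ => hslot 1 ν).trans hsum)
  · exact (scalar_l2loc2_le A μ ζ).trans ((htslot 2).trans hunit)
  · exact (scalar_l2loc3_le A μ ζ).trans ((htslot 3).trans hunit)
  · exact (scalar_l2loc4_le A μ ζ).trans ((Finset.sum_le_sum fun ν _ => hslot 4 ν).trans hsum)
  · show (0 : ℝ) ≤ _
    exact mul_nonneg (mul_nonneg (mul_nonneg (by positivity) hE0) hz) hnA

end Families

/-! ### The family of record over all tori (P.d = d, P.L = L, K ≥ 1) -/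

section Top

variable (d L : ℕ) (hd : 1 ≤ d) (hL : Odd L ∧ 1 < L) {a msq : ℝ} (ha : 0 < a) (hm : 0 ≤ msq)

/-- **The diagonal G₀-family of record**: all tori with P.d = d, P.L = L, K ≥ 1 (index `B5ResidualGpTorusHolds.TopIdx`),
k = K. [cite: Balaban1984PropagatorsI, (1.132) p.39, Prop. 1.2 pp.35–36] -/
def famDiagTop (a msq : ℝ) : B5ResidualGpTorusHolds.TopIdx d L → B5.Setting := fun i => g0Diag i.P a msq i.P.K

/-- The family of record is `famDiag` over the index of record (definitional). [cite: Balaban1984PropagatorsI, (1.132) p.39] -/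
theorem famDiagTop_eq (a msq : ℝ) :
    famDiagTop d L a msq = famDiag (fun i : B5ResidualGpTorusHolds.TopIdx d L => i.P) a msq := rfl

include hd hL ha hm in
/-- **PROPOSITION 1.2 FOR THE DIAGONAL G₀ ON THE TORUS from «Proposition 1.1 for G₀» (scalar family of record) and
«(1.114) for G₀» (diagonal family of record) ALONE**: (1.114) descends to the scalar members (`local114_scalar_of_diag`),
the scalar Prop. 1.2 is `B5Display133G0Torus.prop12G0_torus_top`, and the diagonal Prop. 1.2 assembles
(`prop12_diag_of_scalar`). [cite: Balaban1984PropagatorsI, Prop. 1.2 (1.110)–(1.114) pp.35–36, (1.132)–(1.134) p.39] -/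
theorem prop12Diag_top (h11G0 : B5.Prop11Printed (famG0Top d L a msq))
    (h114 : B5.Local114Fam (famDiagTop d L a msq)) : B5.Prop12Printed (famDiagTop d L a msq) := by
  -- (1.114) for the scalar family over (torus, μ), then transported to the index of record `G0TopIdx`
  have hLS : B5.Local114Fam (famScalar (fun i : B5ResidualGpTorusHolds.TopIdx d L => i.P) a msq) :=
    local114_scalar_of_diag (fun i : B5ResidualGpTorusHolds.TopIdx d L => i.P) a msq (fun i => i.hPd) h114
  have hLtop : B5.Local114Fam (famG0Top d L a msq) :=
    local114_reindex _ (fun i : G0TopIdx d L =>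
      (⟨⟨i.P, i.hPd, i.hPL, i.hK⟩, i.μ⟩ : Σ j : B5ResidualGpTorusHolds.TopIdx d L, Fin j.P.d)) hLS
  -- Prop. 1.2 for the scalar family of record, then on the Σ-index
  have h12 : B5.Prop12Printed (famG0Top d L a msq) :=
    B5Display133G0Torus.prop12G0_torus_top d L hd hL ha hm h11G0 (fun _ => hLtop)
  have h12S : B5.Prop12Printed (famScalar (fun i : B5ResidualGpTorusHolds.TopIdx d L => i.P) a msq) :=
    prop12_reindex _ (fun j : (Σ i : B5ResidualGpTorusHolds.TopIdx d L, Fin i.P.d) =>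
      (⟨j.1.P, j.1.hPd, j.1.hPL, j.1.hK, j.2⟩ : G0TopIdx d L)) h12
  exact prop12_diag_of_scalar _ a msq h12S h114

end Top

end B5G0DiagTorus

end

end Literature.MathematicalPhysics.QuantumFieldTheory.Balaban1983to89
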